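import Summits.QuantumFields.QCD.Theses.SpectralDefectExtinction
import Summits.QuantumFields.QCD.Theorems.ExtinctionBuildsQCD.Negative.TightPinsLine
import Summits.QuantumFields.QCD.Theorems.WindowExtinction.Negative.SpectralFlowLocal
import Literature.MathematicalPhysics.QuantumLattice.GrassmannIntegralWilsonProofs
import Literature.Barriers.QuantumFields.WilsonDeterminantMassSplitting

/-!
# Negative lemmas for the crux `TipPricing` (item stmt-QuantumFields-8967), V: the TIGHT integrand at
# a negative probe is dominated by the coercivity-defect count at HALF the probe (Weyl counting)

Route `SpectralDefectExtinction` (QCD), crux `TipPricing : TipNoBinding → WegnerEstimate → WindowExtinction`.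
Refuter file (cdisprove seat, cycle 2): sorry-free, no definitions, no positive route-item conclusion.
Certified copy of §11 of the work file `Summits/QuantumFields/QCD/Cruxes/TipPricing/Disproof.lean`, built on
the LANDED sibling toolkit `WindowExtinction/Negative/SpectralFlowLocal.lean` (Weyl's inequality in counting
form `card_filter_lt_neg_le`, `countP_roots_eq_card_filter`; review of p79422) and on
`ExtinctionBuildsQCD/Negative/TightPinsLine.lean` (chiral inertia `negCount_hermitianWilson_eq`).

* `negCount_mem_Icc_of_form_le` — two-sided Weyl count: if `|Re v†(B − A)v| ≤ δ‖v‖²` then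
  `#{λ(A) < −δ} ≤ n₋(B) ≤ #{λ(A) ≤ δ}`.
* `hermitianWilson_eq_pencil`, `abs_re_form_hermitianWilson_sub_le` — `H_W(m) = H_W(0) + mΓ₅`, so the
  form distance between `H_W(m₁)` and `H_W(m₂)` is `≤ |m₂ − m₁|`.
* `tightIntegrand_le_halfProbe_count` — **for every gauge field and every probe `p < 0`:
  `|n₋(Γ₅ D_W(U,p,1)) − 6L⁴| ≤ #{eigenvalues of Γ₅ D_W(U,p/2,1) in (−|p|, |p|)}`** (Weyl counting from
  `H_W(p/2)` to `H_W(p)` and to `H_W(|p|/4)`, where `n₋ = 6L⁴` exactly by chiral inertia).  The right-hand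
  side is exactly the count bounded by the crux's remaining hypothesis `WegnerEstimate` (bare mass
  `p/2 ∈ [−1,0]`, window `ε = |p|`) — but under the QUENCHED measure, whereas TIGHT takes the `|det|`-reweighted
  mean: the "|det|-weighted Wegner bound" of the item's why-might-fail is precisely the missing bridge.  For the
  JUNK LINE (`m_crit ≡ 0`, probe `−a_k M/Z_m(k) → 0⁻`, `Negative/FreeSideObligation.lean`) it reads: TIGHT on
  the free side needs, in phase-quenched mean, at least ONE coercivity defect of `H_W` AT THE TIP (bare mass
  `−a_k M/(2Z_m(k))`, window `a_k M/Z_m(k)`) per scheme torus — obtainable only by volume, as a quenched Wegner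
  bound `C(1+β_k^p)·(a_k M/Z_m(k))·(2L_k+1)⁴` shows.

References: Horn–Johnson, *Matrix Analysis* §4.3 (Weyl), §4.5 (inertia); Edwards–Heller–Narayanan,
Nucl. Phys. B 535 (1998) 403 (spectral flow of `γ₅ D_W(m)`); Wegner, Z. Phys. B 44 (1981) 9.
-/

noncomputable section

namespace Summit.QuantumFields.QCD.Theorems.TipPricing.Negative

open Matrix
open Literature.MathematicalPhysics.QuantumLattice Literature.MathematicalPhysics.QuantumFieldTheory
  Literature.Probability.LatticeModels
open Summit.QuantumFields.QCD.Theorems.ExtinctionBuildsQCD.Negative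
open Summit.QuantumFields.QCD.Theorems.WindowExtinction.Negative

/-! ## Two-sided Weyl count (on the landed `card_filter_lt_neg_le`) -/

section WeylCounting

variable {n : Type*} [Fintype n] [DecidableEq n]

/-- **Two-sided Weyl count.**  If `|Re v†(B − A)v| ≤ δ Σ‖v‖²` then
`#{λ(A) < −δ} ≤ n₋(B) ≤ #{λ(A) ≤ δ}`. -/
theorem negCount_mem_Icc_of_form_le {A B : Matrix n n ℂ} (hA : A.IsHermitian) (hB : B.IsHermitian)
    {δ : ℝ} (hE : ∀ v : n → ℂ, |(star v ⬝ᵥ (B - A) *ᵥ v).re| ≤ δ * ∑ i, ‖v i‖ ^ 2) :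
    (Finset.univ.filter fun i => hA.eigenvalues i < -δ).card ≤
        (Finset.univ.filter fun i => hB.eigenvalues i < 0).card ∧
      (Finset.univ.filter fun i => hB.eigenvalues i < 0).card ≤
        (Finset.univ.filter fun i => hA.eigenvalues i ≤ δ).card := by
  constructor
  · have h := card_filter_lt_neg_le hA hB (σ := 1) (δ := δ) (Or.inl rfl) hE
    simpa only [one_mul] using h
  · -- complement: #{λ(B) < 0} ≤ n − #{λ(B) > 0} ≤ n − #{λ(A) > δ} = #{λ(A) ≤ δ}
    have h := card_filter_lt_neg_le hA hB (σ := -1) (δ := δ) (Or.inr rfl) hE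
    simp only [neg_one_mul, neg_lt_neg_iff, neg_lt_zero] at h
    -- h : #{δ < λ(A)} ≤ #{0 < λ(B)}
    have hBsplit := Finset.card_filter_add_card_filter_not
      (s := (Finset.univ : Finset n)) (fun i => 0 < hB.eigenvalues i)
    have hAsplit := Finset.card_filter_add_card_filter_not
      (s := (Finset.univ : Finset n)) (fun i => δ < hA.eigenvalues i)
    have hB' : (Finset.univ.filter fun i => hB.eigenvalues i < 0).card ≤
        (Finset.univ.filter fun i => ¬ 0 < hB.eigenvalues i).card :=
      Finset.card_le_card (Finset.monotone_filter_right _ fun i _ hi => not_lt.mpr hi.le)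
    have hA' : (Finset.univ.filter fun i => ¬ δ < hA.eigenvalues i).card =
        (Finset.univ.filter fun i => hA.eigenvalues i ≤ δ).card := by
      congr 1
      exact Finset.filter_congr fun i _ => not_lt
    omega

end WeylCounting

/-! ## The TIGHT integrand at a negative probe is dominated by the coercivity-defect count at half probe -/

section HalfProbe

variable {L : ℕ} [NeZero L]

/-- The chirality form `⟨v, Γ₅ v⟩` is real with modulus at most `‖v‖²`. -/
theorem abs_re_star_dotProduct_gammaFive_mulVec_le (v : QuarkIdx L → ℂ) :
    |(star v ⬝ᵥ spinorLift gammaFive *ᵥ v).re| ≤ ∑ i, ‖v i‖ ^ 2 := by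
  rw [spinorLift_gammaFive_eq_diagonal, dotProduct, Complex.re_sum]
  refine (Finset.abs_sum_le_sum_abs _ _).trans (Finset.sum_le_sum fun p _ => ?_)
  rw [mulVec_diagonal, Pi.star_apply]
  calc |(star (v p) * ((![1, 1, -1, -1] : Fin 4 → ℂ) p.2.2 * v p)).re|
        ≤ ‖star (v p) * ((![1, 1, -1, -1] : Fin 4 → ℂ) p.2.2 * v p)‖ := Complex.abs_re_le_norm _
    _ = ‖v p‖ ^ 2 := by
        rw [norm_mul, norm_mul, norm_star]
        have : ‖(![1, 1, -1, -1] : Fin 4 → ℂ) p.2.2‖ = 1 := by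
          rcases p with ⟨x, a, α⟩; fin_cases α <;> simp
        rw [this, one_mul, sq]

/-- The Hermitian Wilson–Dirac pencil: `H_W(m) = H_W(0) + m Γ₅`. -/
theorem hermitianWilson_eq_pencil (U : GaugeConfig 4 L SU3) (m : ℝ) :
    spinorLift gammaFive * wilsonDirac (fundamentalRep (Fin 3)) U m 1 =
      spinorLift gammaFive * wilsonDirac (fundamentalRep (Fin 3)) U 0 1 +
        (m : ℂ) • (spinorLift gammaFive : Matrix _ _ ℂ) := by
  have h : wilsonDirac (fundamentalRep (Fin 3)) U m 1 =
      wilsonDirac (fundamentalRep (Fin 3)) U 0 1 + (m : ℂ) • (1 : Matrix _ _ ℂ) := by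
    rw [wilsonDirac_eq_sub_sum_wilsonHop _ fundamentalRep_mem_unitaryGroup U m,
      wilsonDirac_eq_sub_sum_wilsonHop _ fundamentalRep_mem_unitaryGroup U 0,
      sub_add_eq_add_sub, ← add_smul, ← Complex.ofReal_add, zero_add, add_comm 4 m]
  rw [h, mul_add, Matrix.mul_smul, mul_one]

/-- The form bound of the pencil: `|Re v†(H_W(m₂) − H_W(m₁))v| ≤ |m₂ − m₁| Σ‖v‖²`. -/
theorem abs_re_form_hermitianWilson_sub_le (U : GaugeConfig 4 L SU3) (m₁ m₂ : ℝ) (v : QuarkIdx L → ℂ) :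
    |(star v ⬝ᵥ (spinorLift gammaFive * wilsonDirac (fundamentalRep (Fin 3)) U m₂ 1 -
        spinorLift gammaFive * wilsonDirac (fundamentalRep (Fin 3)) U m₁ 1) *ᵥ v).re| ≤
      |m₂ - m₁| * ∑ i, ‖v i‖ ^ 2 := by
  have hdiff : spinorLift gammaFive * wilsonDirac (fundamentalRep (Fin 3)) U m₂ 1 -
      spinorLift gammaFive * wilsonDirac (fundamentalRep (Fin 3)) U m₁ 1 =
        ((m₂ - m₁ : ℝ) : ℂ) • (spinorLift gammaFive : Matrix (QuarkIdx L) (QuarkIdx L) ℂ) := by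
    rw [hermitianWilson_eq_pencil U m₂, hermitianWilson_eq_pencil U m₁, add_sub_add_left_eq_sub,
      ← sub_smul, ← Complex.ofReal_sub]
  rw [hdiff, smul_mulVec, dotProduct_smul, smul_eq_mul, Complex.re_ofReal_mul, abs_mul]
  exact mul_le_mul_of_nonneg_left (abs_re_star_dotProduct_gammaFive_mulVec_le v) (abs_nonneg _)

/-- **HALF-PROBE DOMINATION (pathwise, every gauge field).**  For a probe mass `p < 0`, the TIGHT
integrand is bounded by the number of eigenvalues of the Hermitian Wilson–Dirac operator at HALF the
probe inside the window `(−|p|, |p|)` — the coercivity-defect / WegnerEstimate count at bare mass `p/2`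
and window `|p|`:
`|n₋(Γ₅ D_W(U, p, 1)) − 6L⁴| ≤ #{eigenvalues z of Γ₅ D_W(U, p/2, 1) with |z| < |p|}`.
Proof: Weyl counting between `H_W(p/2)` and `H_W(p)` (form distance `|p|/2`) and between `H_W(p/2)` and
`H_W(|p|/4) ` (positive mass, where `n₋ = 6L⁴` exactly, `negCount_hermitianWilson_eq`; form distance
`3|p|/4`).  For the junk line of the crux (`m_crit ≡ 0`, probe `−a_k M/Z_m(k) → 0⁻`) this says: TIGHT on
the free side needs, in phase-quenched mean, `≥ 1` coercivity defect AT THE TIP per scheme torus. -/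
theorem tightIntegrand_le_halfProbe_count (U : GaugeConfig 4 L SU3) {p : ℝ} (hp : p < 0) :
    |((Multiset.countP (fun z : ℂ => z.re < 0)
        (spinorLift gammaFive * wilsonDirac (fundamentalRep (Fin 3)) U p 1).charpoly.roots : ℝ) -
        6 * (L : ℝ) ^ 4)| ≤
      (Multiset.countP (fun z : ℂ => |z.re| < -p)
        (spinorLift gammaFive * wilsonDirac (fundamentalRep (Fin 3)) U (p / 2) 1).charpoly.roots : ℝ) := by
  have hρ := (fundamentalRep_mem_unitaryGroup : ∀ g : SU3, fundamentalRep (Fin 3) g ∈ Matrix.unitaryGroup (Fin 3) ℂ)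
  set A := spinorLift gammaFive * wilsonDirac (fundamentalRep (Fin 3)) U (p / 2) 1 with hAdef
  set B := spinorLift gammaFive * wilsonDirac (fundamentalRep (Fin 3)) U p 1 with hBdef
  set C := spinorLift gammaFive * wilsonDirac (fundamentalRep (Fin 3)) U (-p / 4) 1 with hCdef
  have hA : A.IsHermitian :=
    Literature.Barriers.QuantumFields.isHermitian_gammaFive_mul_wilsonDirac _ hρ U _ 1
  have hB : B.IsHermitian :=
    Literature.Barriers.QuantumFields.isHermitian_gammaFive_mul_wilsonDirac _ hρ U _ 1
  have hC : C.IsHermitian :=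
    Literature.Barriers.QuantumFields.isHermitian_gammaFive_mul_wilsonDirac _ hρ U _ 1
  -- form distances
  have hEB : ∀ v, |(star v ⬝ᵥ (B - A) *ᵥ v).re| ≤ (-p / 2) * ∑ i, ‖v i‖ ^ 2 := by
    intro v
    have h := abs_re_form_hermitianWilson_sub_le U (p / 2) p v
    have : |p - p / 2| = -p / 2 := by rw [abs_of_neg (by linarith)]; ring
    rwa [this] at h
  have hEC : ∀ v, |(star v ⬝ᵥ (C - A) *ᵥ v).re| ≤ (-(3 * p) / 4) * ∑ i, ‖v i‖ ^ 2 := by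
    intro v
    have h := abs_re_form_hermitianWilson_sub_le U (p / 2) (-p / 4) v
    have : |-p / 4 - p / 2| = -(3 * p) / 4 := by rw [abs_of_pos (by linarith)]; ring
    rwa [this] at h
  obtain ⟨hB1, hB2⟩ := negCount_mem_Icc_of_form_le hA hB hEB
  obtain ⟨hC1, hC2⟩ := negCount_mem_Icc_of_form_le hA hC hEC
  -- `n₋(C) = 6 L⁴` (positive mass)
  have hCcount : (Finset.univ.filter fun i => hC.eigenvalues i < 0).card = 6 * L ^ 4 := by
    have h := negCount_hermitianWilson_eq (L := L) (m₀ := -p / 4) (Or.inl (by linarith)) U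
    rw [← hCdef, countP_roots_eq_card_filter hC (fun x => x < 0)] at h
    exact h
  -- convert root counts to eigenvalue counts
  rw [countP_roots_eq_card_filter hB (fun x => x < 0),
    countP_roots_eq_card_filter hA (fun x => |x| < -p)]
  rw [hCcount] at hC1 hC2
  -- the window count dominates both one-sided differences
  have hwin1 : (Finset.univ.filter fun i => hA.eigenvalues i ≤ -p / 2).card ≤
      (Finset.univ.filter fun i => hA.eigenvalues i < -(-(3 * p) / 4)).card +
        (Finset.univ.filter fun i => |hA.eigenvalues i| < -p).card := by
    refine le_trans (Finset.card_le_card fun i hi => ?_) (Finset.card_union_le _ _)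
    simp only [Finset.mem_filter, Finset.mem_univ, true_and, Finset.mem_union] at hi ⊢
    by_cases h : hA.eigenvalues i < -(-(3 * p) / 4)
    · exact Or.inl h
    · right; rw [abs_lt]; constructor <;> linarith [not_lt.mp h]
  have hwin2 : (Finset.univ.filter fun i => hA.eigenvalues i ≤ -(3 * p) / 4).card ≤
      (Finset.univ.filter fun i => hA.eigenvalues i < -(-p / 2)).card +
        (Finset.univ.filter fun i => |hA.eigenvalues i| < -p).card := by
    refine le_trans (Finset.card_le_card fun i hi => ?_) (Finset.card_union_le _ _)
    simp only [Finset.mem_filter, Finset.mem_univ, true_and, Finset.mem_union] at hi ⊢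
    by_cases h : hA.eigenvalues i < -(-p / 2)
    · exact Or.inl h
    · right; rw [abs_lt]; constructor <;> linarith [not_lt.mp h]
  rw [abs_le]
  constructor
  · -- lower: n₋(B) − 6L⁴ ≥ −count
    have h1 : ((Finset.univ.filter fun i => hA.eigenvalues i < -(-p / 2)).card : ℝ) ≤
        (Finset.univ.filter fun i => hB.eigenvalues i < 0).card := by exact_mod_cast hB1
    have h2 : ((6 * L ^ 4 : ℕ) : ℝ) ≤ (Finset.univ.filter fun i => hA.eigenvalues i ≤ -(3 * p) / 4).card := by
      exact_mod_cast hC2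
    have h3 : ((Finset.univ.filter fun i => hA.eigenvalues i ≤ -(3 * p) / 4).card : ℝ) ≤
        (Finset.univ.filter fun i => hA.eigenvalues i < -(-p / 2)).card +
          (Finset.univ.filter fun i => |hA.eigenvalues i| < -p).card := by exact_mod_cast hwin2
    push_cast at h2
    linarith
  · -- upper: n₋(B) − 6L⁴ ≤ count
    have h1 : ((Finset.univ.filter fun i => hB.eigenvalues i < 0).card : ℝ) ≤
        (Finset.univ.filter fun i => hA.eigenvalues i ≤ -p / 2).card := by exact_mod_cast hB2
    have h2 : ((Finset.univ.filter fun i => hA.eigenvalues i < -(-(3 * p) / 4)).card : ℝ) ≤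
        ((6 * L ^ 4 : ℕ) : ℝ) := by exact_mod_cast hC1
    have h3 : ((Finset.univ.filter fun i => hA.eigenvalues i ≤ -p / 2).card : ℝ) ≤
        (Finset.univ.filter fun i => hA.eigenvalues i < -(-(3 * p) / 4)).card +
          (Finset.univ.filter fun i => |hA.eigenvalues i| < -p).card := by exact_mod_cast hwin1
    push_cast at h2
    linarith

end HalfProbe

end Summit.QuantumFields.QCD.Theorems.TipPricing.Negative

end
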